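import Mathlib
import HarnessLib

/-!
# Item `LrcModEntire` (stmt-NavierStokesRegularity-20428) — (Q3) toolkit, part 3: REGULARITY OF THE LIMIT BRANCH
# (a `C¹` unit-speed curve inside a uniformly non-degenerate critical set is `C^∞`)

ns-k2-port-2 g5 (helper prover under the LEAD of item 20428, ns-poloidal-K2-p3 g14; `--supports stmt-NavierStokesRegularity-20428 --as helper`).
The hull step `…LrcModEntireRidgeHull.exists_hullLimit_branch` returns the limit branch `Γ` of a hull limit `U` only as a `C¹` unit-speed curve (Arzelà–Ascoli loses a
derivative), HOT and CRITICAL for `U` with `−D²f_U(Γ s)(ν_Γ s, ν_Γ s) ≥ κ₀ > 0`.  To ITERATE the hull step (memo `Cruxes/LrcModEntire/T2B-g14.md` §10 (Q3): re-pin along `Γ`,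
next order) one needs `Γ ∈ C²` again.  This file proves, WITHOUT the implicit function theorem, that such a `Γ` is in fact `C^∞`:

* `hessian_apply_deriv_eq_zero` — (any normed space) the Hessian of `f` kills the velocity of a differentiable curve inside `{∇f = 0}`;
* `unit_perp_eq` — planar algebra: a unit vector orthogonal to a non-zero `(a,b)` is `±(−b,a)/√(a²+b²)`; `eventually_eq_of_sq_eq_one` — a continuous `±1`-valued sign is
  locally constant;
* `contDiff_of_unitSpeed_criticalBranch` — **`f : ℝ³ → ℝ` smooth, `Γ : ℝ → P₀ = {y₂ = 0}` of class `C¹` with Euclidean unit speed, `∇f ∘ Γ = 0`, and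
  `D²f(Γ s)(ν_Γ s)(ν_Γ s) ≤ −κ₀ < 0` for the in-plane normal `ν_Γ = (−Γ′₁, Γ′₀, 0)` ⇒ `ContDiff ℝ ∞ Γ`.**
  Proof: near `s₀`, with `n₀ = ν_Γ s₀` frozen and `φ = ∂_{n₀} f`, the planar gradient `M = (∂₀φ, ∂₁φ)` does not vanish near `Γ s₀` (`φ`'s derivative along `n₀` is
  `D²f(n₀,n₀) ≤ −κ₀`) and is orthogonal to `Γ′` (`φ ∘ Γ ≡ 0`); a planar unit vector orthogonal to `M` is `±JM/|M|`, the sign is locally constant by continuity, so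
  `Γ′ = ε₀ • T ∘ Γ` near `s₀` with `T = JM/|M|` smooth — and `Γ ∈ Cᵏ ⇒ Γ′ ∈ Cᵏ ⇒ Γ ∈ Cᵏ⁺¹` bootstraps (`contDiff_succ_iff_deriv`).

WHAT THIS IS NOT: not a claim about Navier–Stokes regularity — calculus for the (Q3) hull iteration of the «ridge quasiconvexity» lever (bears_on LADDER-NS N0, item 20428 /
crux 19708; 20428/19708/27893 OPEN).  No summit statement is proved here.
-/

noncomputable section

-- the summit and its single sub-problem share the name (CONVENTIONS §1), as in every Theorems file
set_option linter.dupNamespace false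

namespace Summit.NavierStokesRegularity.NavierStokesRegularity.Theorems.PoloidalWindowDoorLrcModEntireRidgeBranchRegularity

open Set Filter Topology Function
open scoped ContDiff

/-- **The Hessian kills the velocity of a critical curve** (any real normed space): `f` of class `C²`, `γ` differentiable with `∇f(γ s) = 0` for all `s` ⇒
`D²f(γ s)(γ′ s) = 0`. [folklore] -/
theorem hessian_apply_deriv_eq_zero {E : Type*} [NormedAddCommGroup E] [NormedSpace ℝ E] {f : E → ℝ} {γ : ℝ → E} {n : WithTop ℕ∞}
    (hf : ContDiff ℝ n f) (hn : 2 ≤ n) (hγ : Differentiable ℝ γ) (hcrit : ∀ s, fderiv ℝ f (γ s) = 0) (s : ℝ) :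
    fderiv ℝ (fderiv ℝ f) (γ s) (deriv γ s) = 0 := by
  have hD1 : Differentiable ℝ (fderiv ℝ f) := (hf.fderiv_right (m := 1) (le_trans (by norm_num) hn)).differentiable (by simp)
  have h1 : HasDerivAt (fun s => fderiv ℝ f (γ s)) (fderiv ℝ (fderiv ℝ f) (γ s) (deriv γ s)) s :=
    (hD1 (γ s)).hasFDerivAt.comp_hasDerivAt s (hγ s).hasDerivAt
  have h2 : HasDerivAt (fun s => fderiv ℝ f (γ s)) 0 s := by
    have : (fun s => fderiv ℝ f (γ s)) = fun _ => (0 : E →L[ℝ] ℝ) := funext hcrit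
    rw [this]; exact hasDerivAt_const s 0
  exact h1.unique h2

/-- The explicit planar vector `(a, b, 0)` as `a e₀ + b e₁`. [folklore] -/
theorem toLp_eq_smul_add_smul (a b : ℝ) :
    (WithLp.toLp 2 ![a, b, 0] : EuclideanSpace ℝ (Fin 3)) = a • EuclideanSpace.single 0 (1 : ℝ) + b • EuclideanSpace.single 1 (1 : ℝ) := by
  -- (cf. `…LeafUniformHFlat.horizontal_decomp'` for the general horizontal vector)
  ext i
  fin_cases i <;> simp

/-- A `{−1, 1}`-valued function continuous at a point is eventually equal to its value there. [folklore] -/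
theorem eventually_eq_of_sq_eq_one {ε : ℝ → ℝ} {s₀ : ℝ} (hc : ContinuousAt ε s₀) (hsq : ∀ᶠ s in 𝓝 s₀, ε s ^ 2 = 1) :
    ∀ᶠ s in 𝓝 s₀, ε s = ε s₀ := by
  have h0 : ε s₀ ^ 2 = 1 := hsq.self_of_nhds
  have hlt : ∀ᶠ s in 𝓝 s₀, dist (ε s) (ε s₀) < 1 := (Metric.tendsto_nhds.1 hc) 1 one_pos
  filter_upwards [hsq, hlt] with s hs hd
  rw [Real.dist_eq] at hd
  have h1 : ε s = 1 ∨ ε s = -1 := by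
    have : (ε s - 1) * (ε s + 1) = 0 := by nlinarith
    rcases mul_eq_zero.1 this with h | h
    · left; linarith
    · right; linarith
  have h2 : ε s₀ = 1 ∨ ε s₀ = -1 := by
    have : (ε s₀ - 1) * (ε s₀ + 1) = 0 := by nlinarith
    rcases mul_eq_zero.1 this with h | h
    · left; linarith
    · right; linarith
  rcases h1 with h1 | h1 <;> rcases h2 with h2 | h2
  · rw [h1, h2]
  · exfalso; rw [h1, h2] at hd; norm_num at hd
  · exfalso; rw [h1, h2] at hd; norm_num at hd
  · rw [h1, h2]

/-- Planar algebra: a unit vector `(p,q)` orthogonal to a non-zero `(a,b)` is `ε·(−b,a)/√(a²+b²)` with `ε = (qa − pb)/√(a²+b²)`, `ε² = 1`. [folklore] -/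
theorem unit_perp_eq {p q a b : ℝ} (ho : p * a + q * b = 0) (hu : p ^ 2 + q ^ 2 = 1) (hD : 0 < a ^ 2 + b ^ 2) :
    ((q * a - p * b) / Real.sqrt (a ^ 2 + b ^ 2)) ^ 2 = 1 ∧
      p = (q * a - p * b) / Real.sqrt (a ^ 2 + b ^ 2) * (-b / Real.sqrt (a ^ 2 + b ^ 2)) ∧
      q = (q * a - p * b) / Real.sqrt (a ^ 2 + b ^ 2) * (a / Real.sqrt (a ^ 2 + b ^ 2)) := by
  have hr0 : 0 < Real.sqrt (a ^ 2 + b ^ 2) := Real.sqrt_pos.2 hD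
  have hrr : Real.sqrt (a ^ 2 + b ^ 2) ^ 2 = a ^ 2 + b ^ 2 := Real.sq_sqrt hD.le
  have hpa : p * (a ^ 2 + b ^ 2) = (q * a - p * b) * -b := by linear_combination a * ho
  have hqa : q * (a ^ 2 + b ^ 2) = (q * a - p * b) * a := by linear_combination b * ho
  have hl2 : (q * a - p * b) ^ 2 = a ^ 2 + b ^ 2 := by linear_combination (-(p * a + q * b)) * ho + (a ^ 2 + b ^ 2) * hu
  refine ⟨?_, ?_, ?_⟩
  · rw [div_pow, hl2, hrr, div_self hD.ne']
  · rw [div_mul_div_comm, eq_div_iff (by positivity), ← sq, hrr]; exact hpa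
  · rw [div_mul_div_comm, eq_div_iff (by positivity), ← sq, hrr]; exact hqa

/-- **REGULARITY OF A NON-DEGENERATE CRITICAL BRANCH.**  See the module docstring: a `C¹` unit-speed curve in the plane `{y₂ = 0}` inside the critical set of a smooth
`f : ℝ³ → ℝ`, with `D²f(Γ s)(ν_Γ s)(ν_Γ s) ≤ −κ₀ < 0` on the in-plane normal, is `C^∞`. [folklore] -/
theorem contDiff_of_unitSpeed_criticalBranch {f : EuclideanSpace ℝ (Fin 3) → ℝ} (hf : ContDiff ℝ ∞ f)
    {Γ : ℝ → EuclideanSpace ℝ (Fin 3)} (hΓ : ContDiff ℝ 1 Γ) (hplane : ∀ s, Γ s 2 = 0) (hunit : ∀ s, ‖deriv Γ s‖ = 1)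
    (hcrit : ∀ s, fderiv ℝ f (Γ s) = 0) {κ₀ : ℝ} (hκ₀ : 0 < κ₀)
    (hκ : ∀ s, fderiv ℝ (fderiv ℝ f) (Γ s) (WithLp.toLp 2 ![-(deriv Γ s 1), deriv Γ s 0, 0]) (WithLp.toLp 2 ![-(deriv Γ s 1), deriv Γ s 0, 0]) ≤ -κ₀) :
    ContDiff ℝ ∞ Γ := by
  set e₀ : EuclideanSpace ℝ (Fin 3) := EuclideanSpace.single 0 1 with he₀
  set e₁ : EuclideanSpace ℝ (Fin 3) := EuclideanSpace.single 1 1 with he₁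
  have hΓd : Differentiable ℝ Γ := hΓ.differentiable one_ne_zero
  have hΓ'c : Continuous (deriv Γ) := hΓ.continuous_deriv le_rfl
  have hD1 : ContDiff ℝ ∞ (fderiv ℝ f) := hf.fderiv_right le_rfl
  -- coordinates of `Γ′`: third vanishes, first two form a Euclidean unit vector
  have hΓ'2 : ∀ s, deriv Γ s 2 = 0 := fun s => by
    have h1 : HasDerivAt (fun s => Γ s 2) (deriv Γ s 2) s :=
      ((EuclideanSpace.proj (𝕜 := ℝ) (2 : Fin 3)).hasFDerivAt).comp_hasDerivAt s (hΓd s).hasDerivAt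
    have h2 : HasDerivAt (fun s => Γ s 2) 0 s := by
      have : (fun s => Γ s 2) = fun _ => (0 : ℝ) := funext hplane
      rw [this]; exact hasDerivAt_const s 0
    exact h1.unique h2
  have hsq : ∀ s, deriv Γ s 0 ^ 2 + deriv Γ s 1 ^ 2 = 1 := fun s => by
    have h := EuclideanSpace.real_norm_sq_eq (deriv Γ s)
    rw [hunit s, one_pow, Fin.sum_univ_three, hΓ'2 s] at h
    linarith
  have hΓ'dec : ∀ s, deriv Γ s = deriv Γ s 0 • e₀ + deriv Γ s 1 • e₁ := fun s => by
    -- a horizontal vector is `x₀ e₀ + x₁ e₁` (as `…LeafUniformHFlat.horizontal_decomp'`)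
    ext i
    fin_cases i <;> simp [he₀, he₁, hΓ'2 s]
  -- ## local representation `Γ′ = ε₀ • T ∘ Γ` near every `s₀`, with `T` smooth; then bootstrap
  -- the claim we bootstrap on: `deriv Γ` is `Cᵏ` whenever `Γ` is
  have key : ∀ k : ℕ, ContDiff ℝ k Γ → ContDiff ℝ k (deriv Γ) := by
    intro k hk
    refine contDiff_iff_contDiffAt.2 fun s₀ => ?_
    -- frozen normal and the scalar `φ = ∂_{n₀} f`
    set p₀ : ℝ := deriv Γ s₀ 0 with hp₀
    set q₀ : ℝ := deriv Γ s₀ 1 with hq₀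
    set n₀ : EuclideanSpace ℝ (Fin 3) := WithLp.toLp 2 ![-q₀, p₀, 0] with hn₀
    set A : (EuclideanSpace ℝ (Fin 3) →L[ℝ] ℝ) →L[ℝ] ℝ := ContinuousLinearMap.apply ℝ ℝ n₀ with hA
    set φ : EuclideanSpace ℝ (Fin 3) → ℝ := fun y => fderiv ℝ f y n₀ with hφ
    have hφA : φ = A ∘ fderiv ℝ f := by funext y; simp [hφ, hA]
    have hφs : ContDiff ℝ ∞ φ := by rw [hφA]; exact A.contDiff.comp hD1
    have hφd : Differentiable ℝ φ := hφs.differentiable (by simp)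
    have hDφs : ContDiff ℝ ∞ (fderiv ℝ φ) := hφs.fderiv_right le_rfl
    have hDφ : ∀ y w, fderiv ℝ φ y w = fderiv ℝ (fderiv ℝ f) y w n₀ := by
      intro y w
      have h : HasFDerivAt φ (A.comp (fderiv ℝ (fderiv ℝ f) y)) y := by
        rw [hφA]; exact A.hasFDerivAt.comp y ((hD1.differentiable (by simp)) y).hasFDerivAt
      rw [h.fderiv]; simp [hA]
    -- the planar gradient `(a, b)` of `φ`
    set a : EuclideanSpace ℝ (Fin 3) → ℝ := fun y => fderiv ℝ φ y e₀ with ha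
    set b : EuclideanSpace ℝ (Fin 3) → ℝ := fun y => fderiv ℝ φ y e₁ with hb
    have has : ContDiff ℝ ∞ a := by
      have : a = (ContinuousLinearMap.apply ℝ ℝ e₀) ∘ fderiv ℝ φ := by funext y; simp [ha]
      rw [this]; exact (ContinuousLinearMap.apply ℝ ℝ e₀).contDiff.comp hDφs
    have hbs : ContDiff ℝ ∞ b := by
      have : b = (ContinuousLinearMap.apply ℝ ℝ e₁) ∘ fderiv ℝ φ := by funext y; simp [hb]
      rw [this]; exact (ContinuousLinearMap.apply ℝ ℝ e₁).contDiff.comp hDφs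
    -- (i) orthogonality `p a + q b = 0` along the curve (`φ ∘ Γ ≡ 0`)
    have horth : ∀ s, deriv Γ s 0 * a (Γ s) + deriv Γ s 1 * b (Γ s) = 0 := by
      intro s
      have h1 : HasDerivAt (fun s => φ (Γ s)) (fderiv ℝ φ (Γ s) (deriv Γ s)) s :=
        (hφd (Γ s)).hasFDerivAt.comp_hasDerivAt s (hΓd s).hasDerivAt
      have h2 : HasDerivAt (fun s => φ (Γ s)) 0 s := by
        have : (fun s => φ (Γ s)) = fun _ => (0 : ℝ) := funext fun s => by simp [hφ, hcrit s]
        rw [this]; exact hasDerivAt_const s 0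
      have h0 : fderiv ℝ φ (Γ s) (deriv Γ s) = 0 := h1.unique h2
      rw [hΓ'dec s, map_add, map_smul, map_smul, smul_eq_mul, smul_eq_mul] at h0
      simpa [ha, hb] using h0
    -- (ii) non-degeneracy at `s₀`: `−q₀ a + p₀ b ≤ −κ₀`, so `a² + b² > 0` at `Γ s₀`
    have hnd : -q₀ * a (Γ s₀) + p₀ * b (Γ s₀) ≤ -κ₀ := by
      have h := hκ s₀
      rw [← hp₀, ← hq₀] at h
      have e : fderiv ℝ (fderiv ℝ f) (Γ s₀) n₀ n₀ = fderiv ℝ φ (Γ s₀) n₀ := (hDφ _ _).symm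
      rw [← hn₀, e, hn₀, toLp_eq_smul_add_smul, map_add, map_smul, map_smul, smul_eq_mul, smul_eq_mul] at h
      simpa [ha, hb] using h
    have hpos₀ : 0 < a (Γ s₀) ^ 2 + b (Γ s₀) ^ 2 := by
      by_contra hle
      have h0 : a (Γ s₀) ^ 2 + b (Γ s₀) ^ 2 = 0 := le_antisymm (not_lt.1 hle) (by positivity)
      have ha0 : a (Γ s₀) = 0 := by nlinarith [sq_nonneg (a (Γ s₀)), sq_nonneg (b (Γ s₀))]
      have hb0 : b (Γ s₀) = 0 := by nlinarith [sq_nonneg (a (Γ s₀)), sq_nonneg (b (Γ s₀))]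
      rw [ha0, hb0] at hnd
      linarith
    -- `D s := a(Γ s)² + b(Γ s)²` is continuous and positive near `s₀`
    have hac : Continuous fun s => a (Γ s) := has.continuous.comp hΓ.continuous
    have hbc : Continuous fun s => b (Γ s) := hbs.continuous.comp hΓ.continuous
    have hDc : Continuous fun s => a (Γ s) ^ 2 + b (Γ s) ^ 2 := (hac.pow 2).add (hbc.pow 2)
    have hDpos : ∀ᶠ s in 𝓝 s₀, 0 < a (Γ s) ^ 2 + b (Γ s) ^ 2 := hDc.continuousAt.eventually (isOpen_Ioi.mem_nhds hpos₀)
    -- (iii) the sign `ε s := (q a − p b)/√D` is `±1` near `s₀` and continuous, hence locally constant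
    set ε : ℝ → ℝ := fun s => (deriv Γ s 1 * a (Γ s) - deriv Γ s 0 * b (Γ s)) / Real.sqrt (a (Γ s) ^ 2 + b (Γ s) ^ 2) with hε
    have hp0c : Continuous fun s => deriv Γ s 0 := (EuclideanSpace.proj (𝕜 := ℝ) (0 : Fin 3)).continuous.comp hΓ'c
    have hp1c : Continuous fun s => deriv Γ s 1 := (EuclideanSpace.proj (𝕜 := ℝ) (1 : Fin 3)).continuous.comp hΓ'c
    have hεc : ContinuousAt ε s₀ := by
      refine (((hp1c.mul hac).sub (hp0c.mul hbc)).continuousAt).div (hDc.continuousAt.sqrt) ?_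
      exact (Real.sqrt_pos.2 hpos₀).ne'
    -- algebra: with `p a + q b = 0`, `p² + q² = 1`, `D = a² + b² > 0`: `ε² = 1`, `p = ε(−b)/√D`, `q = ε a/√D`
    have halg : ∀ s, 0 < a (Γ s) ^ 2 + b (Γ s) ^ 2 →
        ε s ^ 2 = 1 ∧ deriv Γ s 0 = ε s * (-(b (Γ s)) / Real.sqrt (a (Γ s) ^ 2 + b (Γ s) ^ 2)) ∧
          deriv Γ s 1 = ε s * (a (Γ s) / Real.sqrt (a (Γ s) ^ 2 + b (Γ s) ^ 2)) := fun s hD =>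
      unit_perp_eq (horth s) (hsq s) hD
    have hεconst : ∀ᶠ s in 𝓝 s₀, ε s = ε s₀ := eventually_eq_of_sq_eq_one hεc (hDpos.mono fun s hs => (halg s hs).1)
    -- (iv) the smooth field `T y := (√(a y² + b y²))⁻¹ • (−b y, a y, 0)` and the local representation
    set T : EuclideanSpace ℝ (Fin 3) → EuclideanSpace ℝ (Fin 3) :=
      fun y => (Real.sqrt (a y ^ 2 + b y ^ 2))⁻¹ • WithLp.toLp 2 ![-(b y), a y, 0] with hT
    have hTs : ContDiffAt ℝ ∞ T (Γ s₀) := by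
      have hq : ContDiffAt ℝ ∞ (fun y => a y ^ 2 + b y ^ 2) (Γ s₀) := ((has.pow 2).add (hbs.pow 2)).contDiffAt
      have hinv : ContDiffAt ℝ ∞ (fun y => (Real.sqrt (a y ^ 2 + b y ^ 2))⁻¹) (Γ s₀) :=
        (hq.sqrt hpos₀.ne').inv (Real.sqrt_pos.2 hpos₀).ne'
      have hvec : ContDiffAt ℝ ∞ (fun y => (WithLp.toLp 2 ![-(b y), a y, 0] : EuclideanSpace ℝ (Fin 3))) (Γ s₀) := by
        rw [contDiffAt_euclidean]
        intro i
        fin_cases i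
        · simpa using hbs.contDiffAt.neg
        · simpa using has.contDiffAt
        · simp; exact contDiffAt_const
      exact hinv.smul hvec
    have hrep : ∀ᶠ s in 𝓝 s₀, deriv Γ s = ε s₀ • T (Γ s) := by
      filter_upwards [hDpos, hεconst] with s hD hεs
      obtain ⟨-, hp, hq⟩ := halg s hD
      rw [hΓ'dec s, hp, hq, ← hεs, hT]
      simp only
      rw [toLp_eq_smul_add_smul, smul_add, smul_smul, smul_smul]
      have e1 : ε s * (-(b (Γ s)) / Real.sqrt (a (Γ s) ^ 2 + b (Γ s) ^ 2)) = ε s * ((Real.sqrt (a (Γ s) ^ 2 + b (Γ s) ^ 2))⁻¹ * -(b (Γ s))) := by ring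
      have e2 : ε s * (a (Γ s) / Real.sqrt (a (Γ s) ^ 2 + b (Γ s) ^ 2)) = ε s * ((Real.sqrt (a (Γ s) ^ 2 + b (Γ s) ^ 2))⁻¹ * a (Γ s)) := by ring
      rw [e1, e2, smul_add, smul_smul, smul_smul]
    -- (v) the composite `ε₀ • T ∘ Γ` is `Cᵏ` at `s₀`
    have hcomp : ContDiffAt ℝ k (fun s => ε s₀ • T (Γ s)) s₀ :=
      ((hTs.of_le (by exact_mod_cast le_top)).comp s₀ hk.contDiffAt).const_smul (ε s₀)
    exact hcomp.congr_of_eventuallyEq hrep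
  -- ## bootstrap
  have hall : ∀ k : ℕ, ContDiff ℝ k Γ := by
    intro k
    induction k with
    | zero => exact hΓ.of_le (by norm_num)
    | succ k ih =>
      rw [show ((k + 1 : ℕ) : WithTop ℕ∞) = (k : WithTop ℕ∞) + 1 by push_cast; rfl, contDiff_succ_iff_deriv]
      exact ⟨hΓd, fun h => absurd h (by simp), key k ih⟩
  exact contDiff_infty.2 hall

end Summit.NavierStokesRegularity.NavierStokesRegularity.Theorems.PoloidalWindowDoorLrcModEntireRidgeBranchRegularity

end
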